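import Literature.MathematicalPhysics.QuantumFieldTheory.Balaban1983to89.B1Prop23RegularRegion

/-!
# `Balaban1983to89.B1Prop23RegularRegionSmall` — T. Bałaban, *(Higgs)₂,₃ quantum fields in a finite volume. I. A lower bound*,
# Commun. Math. Phys. **85** (1982) 603–626 [Balaban1982Higgs1], PROPOSITION 2.3 (2.33)ₗ, (2.34), (2.36) pp. 611–612 AT A REGULAR
# `A ≠ 0` FOR THE PRINTED REGIONS `Ω = B^k(Λ_k)`, **ONE SMALLNESS PARAMETER `L^kδ_A·|e|`** — the region twin of r14 g13's torus
# assembly `B1Props21to23RegularTorus.{ineq233_lower_regular_torus_small, ineq234_236_regular_torus}`: r14 g14's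
# `B1Prop23RegularRegion.prop23_regular_region` packages the smallness of the two inputs as `e² ≦ E₀` AND `L^kδ_A ≦ c|e|` ((2.23) in
# lattice units); here the four smallness conditions of the inputs are discharged from the single product `L^kδ_A·|e| ≦ t₀`
# (`t₀ = t₀(d, L, a, m²) > 0`), so that the (2.23) reading (`L^kδ_A ≦ c|e|`, `e² ≦ E₀ := t₀/c`) is a special case and no separate
# bound on the charge is asked.

statement-level skeleton of published theorems with citation tags; proofs where landed; nothing here is a claim about the Yang–Mills mass gap

PDF held: `paper:balaban1982-cmp85-higgs23-i` (journal page = PDF page + 602), p. 611 [PDF 9] Prop. 2.3 (2.33)–(2.35), p. 612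
[PDF 10] (2.36), p. 610 [PDF 8] (2.23); [Balaban1983RegularityDecay] = `paper:balaban1983-cmp89-regularity-decay` pp. 593–594
[PDF 23–24] Sect. 5 (5.2)–(5.6).

CITATION HEADER (lean-in-tree rule).  Cell `lit-balaban` (HOME `run/shared/lean/pub/lit-balaban/`), PHASE-2 proof seat **p35** gen 16
(unit `lit-balaban-p35-g16`; free target under ruling G.5-34(d), TAKING line HOME/STATUS.md 2026-08-22).  SKELETON row **B1.Prop2.3**
(owner r14; decls of record `B1.Prop23Literal`/`B1.Prop23Intended`, head by p17's `B4Prop23RegularFamily`; concrete-carrier members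
r14 g9 (`A = 0`, regions), r14 g13 (`Ω = T_ε`, general regular `A`, one smallness parameter), r14 g14 `B1Prop23RegularRegion` (regions,
general regular `A`, `e² ≦ E₀ ∧ L^kδ_A ≦ c|e|`)) — THIS file: a MEMBER, the regions case with the single smallness parameter of the
torus member.  USED BY NAME, never restated: r14 g14 `B1Prop23RegularRegion.{lower_supported_regular_region,
hker_regular_region_uniform, ineq234_236_regular_region_of}`, p23 `B2Ineq329RegularField.gamma0_regular_spec`, r14 g7
`B1Ineq234Concrete.{profile, nCol, distC}`, pv09/b04 `B4Sect5Torus.{cSt, dSt, cSt_pos, dSt_pos, profile_nonneg}`, typer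
`B1Eq230FluctCov.{mat, Ix, precOpA}`, `HiggsCondCov232.condCov232`, p15 `B2Eq328ConcretePieces.pieceF`, `B2Eq337ScalarIntegration.Regions`.

WHAT IS PRINTED (verbatim, [B1] p. 611 [PDF 9] l. 30–35, p. 612 [PDF 10] l. 2–4, p. 610 [PDF 8]): *"Here we will assume that the set Λ
is a union of big blocks of T^{(k)}_1. Proposition 2.3. If a configuration A is regular on Ω in the sense defined in Proposition 2.1,
then there exist positive constants δ₀, c₀, γ₀, γ₁ dependent on d and a, and independent of A, k, Ω and Λ, such that"* [(2.33): `γ₀I ≦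
aL^{−2}P(A) + Δ^{(k)}(Ω, A) ≦ γ₁I`] [(2.34): `|C^{(k)}_Λ(Ω, A; x, x′)| ≦ c₀exp(−δ₀|x − x′|)`] *"x, x′ ∈ Λ. (2.34)"*; p. 612: *"|δC^{(k)}_Λ(Ω,
A; x, x′)| ≦ c₀exp(−δ₀(|x − x′| + dist(x, Λᶜ) + dist(x′, Λᶜ))), x, x′ ∈ Λ. (2.36)"*; p. 610 (2.23): *"|(∂^η_μA)(x)| ≦ c(e(L^kε))^{β−1},
x ∈ Ω"* and Prop. 2.1 *"… for e(L^kε) sufficiently small"*.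

DICTIONARY.  As in `B1Prop23RegularRegion`: `Ω^{(k)} = Λ_k ↦ R.block j` (`k = j + 1`), `Ω = B^k(Λ_k) ↦ pieceF R j`, `C^{(k)}_Λ(Ω, A) ↦
condCov232 C (pieceF R j) A m² a k Λ` (in `L^kε`-units), `aL^{−2}P(A) + Δ^{(k)}(Ω, A) ↦ precOpA`, `|x − x′| ↦ Site.tdist`, `dist(x, Λᶜ) ↦
distC Λ`; «A regular on Ω» ↦ `|A ⟨z + εe_ν, μ⟩ − A ⟨z, μ⟩| ≦ δ_A` for `z ∈ Ω`; the smallness «e(L^kε) sufficiently small» ↦ the ONE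
condition `L^kδ_A·|e| ≦ t₀` (for the (2.23) currency `L^kδ_A = ce(L^kε)^β`, `β ≧ 0`, `L^kε ≦ 1`: `ce² ≦ t₀`).

WHAT THIS FILE PROVES (kernel-checked, zero `sorry`, theorems only; axioms standard).
* §1 **`lower_supported_regular_region_small`** — (2.33)ₗ AT A BACKGROUND REGULAR ON `Ω`, SUPPORTED FORM, ONE SMALLNESS PARAMETER: for
  `d`, `L > 1`, `a, m² > 0`, `N` there are `t₀, γ > 0` (`γ = min{a, 4γ₀}/(2L²)`, `γ₀ = min{a(1 − L^{−2})/(8d + 2m² + 4), 1/16}`) such that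
  for every charge, every torus of the model with these `d, L`, every region tower `R` (`K ≦ K_P`), every level `1 ≦ k = j + 1 < K_P` with
  `L^kε ≦ 1` and `Λ_k = R.block j` a union of blocks, every `A` `δ`-regular on `Ω = B^k(Λ_k)` with `L^kδ·|e| ≦ t₀` and every `f` on
  `T^{(k)}` vanishing off `Λ_k`: `γ(L^kε)^{−2}‖f‖² ≦ ⟨f, (a(L^{k+1}ε)^{−2}P(A) + Δ^{(k),L^kε}(Ω, A))f⟩` — r14 g14's
  `lower_supported_regular_region` with its four smallness conditions discharged exactly as in r14 g13's
  `ineq233_lower_regular_torus_small`.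
* §2 **`prop23_regular_region_small`** — PROPOSITION 2.3 (2.34) AND (2.36) AT A REGULAR `A` FOR THE PRINTED REGIONS, ONE SMALLNESS
  PARAMETER: there are `t₀, c₁, δ₁ > 0` (functions of `d, L, a, m², N` only) such that for every charge, torus, region tower, level,
  `A` `δ_A`-regular on `Ω` with `L^kδ_A·|e| ≦ t₀`, every `Λ ⊂ Λ_k` and all `p = (x, i)`, `q = (x′, i′)` over `Λ`:
  `|C^{(k),L^kε}_Λ(Ω, A)(p, q)| ≦ (L^kε)²c₁e^{−δ₁|x − x′|}` and `|(C^{(k),L^kε}_Λ − C^{(k),L^kε})(Ω, A)(p, q)| ≦ (L^kε)²c₁e^{−δ₁(|x − x′| +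
  dist(x,Λᶜ) + dist(x′,Λᶜ))}` (the Cor.-2.3 smallness `d²·ε|e|·L^{2k}·δ_A ≦ 1/3` of `hker_regular_region_uniform` also follows from
  `L^kδ_A|e| ≦ t₀ ≦ 1/(3(d² + 1))` and `L^kε ≦ 1`).  r14 g14's `(E₀, c)`-shape `prop23_regular_region` is the special case
  `E₀ = t₀/(c + 1)` (`L^kδ_A ≦ c|e|`, `e² ≦ E₀` ⟹ `L^kδ_A·|e| ≦ ce² ≦ t₀`); it is NOT re-derived here (same statement ⟹ `dedup`).
HONEST SCOPE / DIVERGENCE.  (i) A re-assembly of r14 g14's inputs — no new analysis; constants crude, depending on `(d, N, L, a, m²)`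
(WEAKER than the printed *"dependent on d and a"*); (ii) `Λ ⊂ Λ_k` arbitrary, `Λ_k` any union of blocks (the printed «big blocks» are
not needed by the Sect.-5 route), regularity of `A` asked on `Ω` only; (iii) the single condition `L^kδ_A·|e| ≦ t₀` is the print's *"for
e(L^kε) sufficiently small"* in the (2.23) currency, with no separate bound on `e` or on `L^kδ_A/|e|`; (iv) METHOD of the inputs:
Combes–Thomas / energy comparison (r14), not the print's random walk; (2.38) not treated; (v) NOT summit progress.
-/

noncomputable section

open scoped BigOperators InnerProductSpace Matrix

namespace Literature.MathematicalPhysics.QuantumFieldTheory.Balaban1983to89.B1Prop23RegularRegionSmall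

open HiggsLattice HiggsCondCov232 B1Eq230FluctCov
open B4Sect5Torus (cSt dSt cSt_pos dSt_pos profile_nonneg)
open B2Eq337ScalarIntegration (Regions)
open B2Eq328ConcretePieces (pieceF)
open B1Ineq234Concrete (profile nCol distC)
open B2Ineq329RegularField (gamma0_regular_spec)
open B1Prop23RegularRegion (lower_supported_regular_region hker_regular_region_uniform ineq234_236_regular_region_of)

/-! ## §1 (2.33)ₗ at a background regular on `Ω`, supported form, one smallness parameter -/

section Lower

/-- The basic square: from `L^kδ·|e| ≦ T ≦ 1` and `L^kε ≦ 1`, `(L^kδ)²·e²·(L^kε)² ≦ T` (elementary; private helper). [folklore] -/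
private theorem sq_le_of_small {Lk δ e s T : ℝ} (hLk : 0 ≤ Lk) (hδ : 0 ≤ δ) (hs0 : 0 ≤ s) (hs : s ≤ 1) (hT1 : T ≤ 1)
    (ht : Lk * δ * |e| ≤ T) : (Lk * δ) ^ 2 * e ^ 2 * s ^ 2 ≤ T := by
  have hu0 : 0 ≤ Lk * δ * |e| := by positivity
  have h1 : (Lk * δ * |e|) ^ 2 ≤ T ^ 2 := pow_le_pow_left₀ hu0 ht 2
  have hT0 : 0 ≤ T := hu0.trans ht
  have h2 : T ^ 2 ≤ T := by nlinarith
  have hs2 : s ^ 2 ≤ 1 := pow_le_one₀ hs0 hs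
  calc (Lk * δ) ^ 2 * e ^ 2 * s ^ 2 = (Lk * δ * |e|) ^ 2 * s ^ 2 := by rw [mul_pow _ |e|, sq_abs]
    _ ≤ T ^ 2 * 1 := mul_le_mul h1 hs2 (sq_nonneg _) (sq_nonneg _)
    _ ≤ T := by rw [mul_one]; exact h2

/-- **(2.33) LOWER HALF AT A BACKGROUND REGULAR ON `Ω`, SUPPORTED FORM, ONE SMALLNESS PARAMETER** — r14 g14's
`lower_supported_regular_region` with its four smallness conditions discharged from `L^kδ·|e| ≦ t₀` (verbatim the arithmetic of r14 g13's
`B1Props21to23RegularTorus.ineq233_lower_regular_torus_small`): for `d`, `L > 1`, `a, m² > 0`, `N` there are `t₀ > 0`, `γ > 0` (functions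
of `d, L, a, m²`; `γ = min{a, 4γ₀}/(2L²)`) such that for every charge, every torus of the model with these `d, L`, every region tower `R`
(`K ≦ K_P`), every level `1 ≦ k = j + 1 < K_P` with `L^kε ≦ 1` and `Λ_k = R.block j` a union of blocks, every `A` `δ`-regular on
`Ω = B^k(Λ_k)` (`|A ⟨z + εe_ν, μ⟩ − A ⟨z, μ⟩| ≦ δ`, `z ∈ Ω`) with `L^kδ·|e| ≦ t₀` and every `f` on `T^{(k)}` vanishing off `Λ_k`:
`γ(L^kε)^{−2}‖f‖² ≦ ⟨f, (a(L^{k+1}ε)^{−2}P(A) + Δ^{(k),L^kε}(Ω, A))f⟩`.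
[cite: Balaban1982Higgs1, Prop. 2.3 (2.33) p.611, Prop. 2.1 (2.23) p.610] [cite: Balaban1983RegularityDecay, Sect. 5 (5.2)–(5.3) p.593] -/
theorem lower_supported_regular_region_small (d L : ℕ) (hL1 : 1 < L) {a msq : ℝ} (ha : 0 < a) (hmsq : 0 < msq) (N : ℕ) :
    ∃ t₀ : ℝ, 0 < t₀ ∧ ∃ γ : ℝ, 0 < γ ∧
      ∀ (C : ChargeData N) (P : HiggsLattice.Params), P.d = d → P.L = L →
      ∀ {K : ℕ} (R : Regions P K), K ≤ P.K → ∀ (j : Fin K), j.val + 1 < P.K → P.mesh (j.val + 1) ≤ 1 →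
      (∀ y y' : HiggsLattice.Site P (j.val + 1),
        HiggsLattice.blockOf y = HiggsLattice.blockOf y' → (y ∈ R.block j ↔ y' ∈ R.block j)) →
      ∀ (A : HiggsLattice.VecField P 0) {δ : ℝ}, 0 ≤ δ →
        (∀ z ∈ pieceF R j, ∀ μ' ν : Fin P.d, |A ⟨z.shift ν, μ'⟩ - A ⟨z, μ'⟩| ≤ δ) →
        (P.L : ℝ) ^ (j.val + 1) * δ * |C.e| ≤ t₀ →
        ∀ (f : ScalarField P (j.val + 1) N), (∀ y, y ∉ R.block j → f y = 0) →
          γ * ((P.mesh (j.val + 1))⁻¹ ^ 2) * siteInner f f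
            ≤ siteInner f (precOpA C (pieceF R j) A msq a (j.val + 1) f) := by
  obtain ⟨γ₀, hγ₀⟩ : ∃ γ₀ : ℝ, γ₀ = min (a * (1 - ((L : ℝ) ^ 2)⁻¹) / (8 * (d : ℝ) + 2 * msq + 4)) (1 / 16) := ⟨_, rfl⟩
  obtain ⟨c₁, hc₁⟩ : ∃ c₁ : ℝ, c₁ = min a (4 * γ₀) / (L : ℝ) ^ 2 := ⟨_, rfl⟩
  obtain ⟨T, hT⟩ : ∃ T : ℝ, T = min 1 (min (1 / (16 * ((d : ℝ) ^ 4 * (L : ℝ) ^ d) + 1))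
      (min (c₁ / (256 * (γ₀ * (d : ℝ) ^ 3) + 1)) (1 / (4 * ((d : ℝ) ^ 3 * (L : ℝ) ^ 4) + 1)))) := ⟨_, rfl⟩
  have hLr : (1 : ℝ) < (L : ℝ) := by exact_mod_cast hL1
  have hγ₀pos : 0 < γ₀ := by
    rw [hγ₀]
    refine lt_min (div_pos (mul_pos ha ?_) (by positivity)) (by norm_num)
    have h1 : (1 : ℝ) < (L : ℝ) ^ 2 := by
      have h := mul_lt_mul hLr hLr.le zero_lt_one (zero_le_one.trans hLr.le)
      rw [one_mul] at h; rw [sq]; exact h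
    have : ((L : ℝ) ^ 2)⁻¹ < 1 := inv_lt_one_of_one_lt₀ h1
    linarith
  have hc₁pos : 0 < c₁ := by rw [hc₁]; exact div_pos (lt_min ha (by linarith)) (by positivity)
  have hX0 : 0 ≤ (d : ℝ) ^ 4 * (L : ℝ) ^ d := by positivity
  have hY0 : 0 ≤ γ₀ * (d : ℝ) ^ 3 := by positivity
  have hZ0 : 0 ≤ (d : ℝ) ^ 3 * (L : ℝ) ^ 4 := by positivity
  have hTpos : 0 < T := by
    rw [hT]
    exact lt_min one_pos (lt_min (by positivity) (lt_min (div_pos hc₁pos (by positivity)) (by positivity)))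
  refine ⟨T, hTpos, c₁ / 2, by linarith, ?_⟩
  intro C P hPd hPL K R hK j hjK hs hU A δ hδ hreg ht f hf
  subst hPd hPL
  have hLnat : 1 < P.L := hL1
  have hmesh : 0 < P.mesh (j.val + 1) := P.mesh_pos _
  have hmeshK : P.mesh (j.val + 1) = (P.L : ℝ) ^ (j.val + 1) * P.mesh 0 := by
    unfold HiggsLattice.Params.mesh; ring
  have hT1 : T ≤ 1 := by rw [hT]; exact min_le_left _ _
  have hLk0 : (0 : ℝ) ≤ (P.L : ℝ) ^ (j.val + 1) := by positivity
  -- the basic square: `(Lᵏδ)²e²(L^kε)² ≤ T`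
  have hsq : ((P.L : ℝ) ^ (j.val + 1) * δ) ^ 2 * C.e ^ 2 * P.mesh (j.val + 1) ^ 2 ≤ T :=
    sq_le_of_small hLk0 hδ hmesh.le hs hT1 ht
  -- the constant `γ₀` of (II.3.29) at a regular field
  obtain ⟨-, hγB, hγ16⟩ := gamma0_regular_spec (P := P) ha hLnat hmsq.le
  rw [← hγ₀] at hγB hγ16
  -- (i) `hsmall`
  have hsmall : 8 * (P.d : ℝ) ^ 4 * (P.L : ℝ) ^ P.d * C.e ^ 2 * P.mesh (j.val + 1) ^ 2 *
      ((P.L : ℝ) ^ (j.val + 1)) ^ 2 * δ ^ 2 ≤ 1 / 2 := by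
    have hTX : T ≤ 1 / (16 * ((P.d : ℝ) ^ 4 * (P.L : ℝ) ^ P.d) + 1) := by
      rw [hT]; exact (min_le_right _ _).trans (min_le_left _ _)
    rw [le_div_iff₀ (by positivity)] at hTX
    calc 8 * (P.d : ℝ) ^ 4 * (P.L : ℝ) ^ P.d * C.e ^ 2 * P.mesh (j.val + 1) ^ 2 * ((P.L : ℝ) ^ (j.val + 1)) ^ 2 * δ ^ 2
        = 8 * ((P.d : ℝ) ^ 4 * (P.L : ℝ) ^ P.d) *
            (((P.L : ℝ) ^ (j.val + 1) * δ) ^ 2 * C.e ^ 2 * P.mesh (j.val + 1) ^ 2) := by ring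
      _ ≤ 8 * ((P.d : ℝ) ^ 4 * (P.L : ℝ) ^ P.d) * T := mul_le_mul_of_nonneg_left hsq (by positivity)
      _ ≤ 1 / 2 := by linarith [mul_nonneg hX0 hTpos.le]
  -- (ii) `hE`
  have hEE : 64 * γ₀ * (P.d : ℝ) ^ 3 * C.e ^ 2 * ((P.L : ℝ) ^ (j.val + 1)) ^ 2 * δ ^ 2 * P.mesh (j.val + 1) ^ 2
      ≤ min a (4 * γ₀) / (P.L : ℝ) ^ 2 / 4 := by
    have hTY : T ≤ c₁ / (256 * (γ₀ * (P.d : ℝ) ^ 3) + 1) := by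
      rw [hT]; exact (min_le_right _ _).trans ((min_le_right _ _).trans (min_le_left _ _))
    rw [le_div_iff₀ (by positivity)] at hTY
    rw [← hc₁]
    calc 64 * γ₀ * (P.d : ℝ) ^ 3 * C.e ^ 2 * ((P.L : ℝ) ^ (j.val + 1)) ^ 2 * δ ^ 2 * P.mesh (j.val + 1) ^ 2
        = 64 * (γ₀ * (P.d : ℝ) ^ 3) * (((P.L : ℝ) ^ (j.val + 1) * δ) ^ 2 * C.e ^ 2 * P.mesh (j.val + 1) ^ 2) := by ring
      _ ≤ 64 * (γ₀ * (P.d : ℝ) ^ 3) * T := mul_le_mul_of_nonneg_left hsq (by positivity)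
      _ ≤ c₁ / 4 := by linarith [mul_nonneg hY0 hTpos.le]
  -- (iii) `hθ`
  have hθ : (P.L : ℝ) ^ 2 * P.d *
      (2 * P.d * P.L * ((P.L : ℝ) ^ (j.val + 1)) ^ 2 * (P.mesh 0 * |C.e|) * δ) ^ 2 ≤ 1 := by
    have hTZ : T ≤ 1 / (4 * ((P.d : ℝ) ^ 3 * (P.L : ℝ) ^ 4) + 1) := by
      rw [hT]; exact (min_le_right _ _).trans ((min_le_right _ _).trans (min_le_right _ _))
    rw [le_div_iff₀ (by positivity)] at hTZ
    have e1 : ((P.L : ℝ) ^ (j.val + 1)) ^ 2 * P.mesh 0 * δ = ((P.L : ℝ) ^ (j.val + 1) * δ) * P.mesh (j.val + 1) := by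
      rw [hmeshK]; ring
    calc (P.L : ℝ) ^ 2 * P.d * (2 * P.d * P.L * ((P.L : ℝ) ^ (j.val + 1)) ^ 2 * (P.mesh 0 * |C.e|) * δ) ^ 2
        = 4 * ((P.d : ℝ) ^ 3 * (P.L : ℝ) ^ 4) * ((((P.L : ℝ) ^ (j.val + 1)) ^ 2 * P.mesh 0 * δ) ^ 2 * |C.e| ^ 2) := by
          ring
      _ = 4 * ((P.d : ℝ) ^ 3 * (P.L : ℝ) ^ 4) *
            (((P.L : ℝ) ^ (j.val + 1) * δ) ^ 2 * C.e ^ 2 * P.mesh (j.val + 1) ^ 2) := by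
          rw [e1, sq_abs]; ring
      _ ≤ 4 * ((P.d : ℝ) ^ 3 * (P.L : ℝ) ^ 4) * T := mul_le_mul_of_nonneg_left hsq (by positivity)
      _ ≤ 1 := by linarith [mul_nonneg hZ0 hTpos.le]
  have hmain := lower_supported_regular_region R C ha hLnat hmsq hK j hjK hs hU A hδ hreg hsmall hγ₀pos.le hγB hγ16 hEE
    hθ f hf
  rw [← hc₁] at hmain
  exact hmain

end Lower

/-! ## §2 Proposition 2.3 (2.34)/(2.36) at a regular `A` for the printed regions, one smallness parameter -/

section Prop23

/-- **[B1] PROPOSITION 2.3 (2.34) AND (2.36) AT A REGULAR `A ≠ 0` FOR THE PRINTED REGIONS, ONE SMALLNESS PARAMETER** (p. 611 *"If a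
configuration A is regular on Ω in the sense defined in Proposition 2.1, then there exist positive constants δ₀, c₀, γ₀, γ₁ …
independent of A, k, Ω and Λ, such that … x, x′ ∈ Λ. (2.34)"*, p. 612 (2.36); Prop. 2.1 *"for e(L^kε) sufficiently small"*): for `d`,
`L > 1`, `a, m² > 0` and `N` there are `t₀, c₁, δ₁ > 0` (functions of `d, L, a, m², N` only) such that for EVERY charge, every torus of
the model with these `d, L` (every volume, every `ε`), every region tower `R` (`K ≦ K_P`), every level `1 ≦ k = j + 1 < K_P` with
`L^kε ≦ 1` and `Λ_k = R.block j` a union of blocks, EVERY `A` regular on `Ω = B^k(Λ_k)` in the sense `|A ⟨z + εe_ν, μ⟩ − A ⟨z, μ⟩| ≦ δ_A`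
(`z ∈ Ω`) with the ONE smallness condition `L^kδ_A·|e| ≦ t₀`, every `Λ ⊂ Λ_k` and all `p = (x, i)`, `q = (x′, i′)` with `x, x′ ∈ Λ`:
`|C^{(k),L^kε}_Λ(Ω, A)(p, q)| ≦ (L^kε)²c₁e^{−δ₁|x − x′|}` and `|(C^{(k),L^kε}_Λ − C^{(k),L^kε})(Ω, A)(p, q)| ≦ (L^kε)²c₁e^{−δ₁(|x − x′| +
dist(x,Λᶜ) + dist(x′,Λᶜ))}` — `(c₁, δ₁) = (cSt, dSt)(N·K_d; γ, c_U, δ₀)` of r14 g14's engine, `c_U = aL^{−2}e^{δ₀(L−1)} + a + a²(2/γ_r)e^{δ₀}`,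
`δ₀ = γ_r/(4d + 4a)`, `γ_r = min{2, a(1 − L^{−2})/4}`.
[cite: Balaban1982Higgs1, Prop. 2.3 (2.34) p.611, (2.36) p.612, Prop. 2.1 (2.23) p.610]
[cite: Balaban1983RegularityDecay, Sect. 5 (5.4) p.593, (5.5)–(5.6) p.594] -/
theorem prop23_regular_region_small (d L : ℕ) (hL1 : 1 < L) {a msq : ℝ} (ha : 0 < a) (hmsq : 0 < msq) (N : ℕ) :
    ∃ t₀ c₁ δ₁ : ℝ, 0 < t₀ ∧ 0 < c₁ ∧ 0 < δ₁ ∧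
      ∀ (C : ChargeData N) (P : HiggsLattice.Params), P.d = d → P.L = L →
      ∀ {K : ℕ} (R : Regions P K), K ≤ P.K → ∀ (j : Fin K), j.val + 1 < P.K → P.mesh (j.val + 1) ≤ 1 →
      (∀ y y' : HiggsLattice.Site P (j.val + 1),
        HiggsLattice.blockOf y = HiggsLattice.blockOf y' → (y ∈ R.block j ↔ y' ∈ R.block j)) →
      ∀ (A : HiggsLattice.VecField P 0) {δA : ℝ}, 0 ≤ δA →
        (∀ z ∈ pieceF R j, ∀ μ' ν : Fin P.d, |A ⟨z.shift ν, μ'⟩ - A ⟨z, μ'⟩| ≤ δA) →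
        (P.L : ℝ) ^ (j.val + 1) * δA * |C.e| ≤ t₀ →
        ∀ {Λ : Finset (HiggsLattice.Site P (j.val + 1))}, Λ ⊆ R.block j →
        ∀ {p q : HiggsLattice.Site P (j.val + 1) × Ix N}, p.1 ∈ Λ → q.1 ∈ Λ →
          |mat (condCov232 C (pieceF R j) A msq a (j.val + 1) Λ) p q| ≤
              P.mesh (j.val + 1) ^ 2 * c₁ * Real.exp (-(δ₁ * (HiggsLattice.Site.tdist p.1 q.1 : ℝ)))
          ∧ |mat (condCov232 C (pieceF R j) A msq a (j.val + 1) Λ) p q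
                - mat (condCov232 C (pieceF R j) A msq a (j.val + 1) (R.block j)) p q| ≤
              P.mesh (j.val + 1) ^ 2 * c₁ * Real.exp (-(δ₁ *
                ((HiggsLattice.Site.tdist p.1 q.1 : ℝ) + distC Λ p.1 + distC Λ q.1))) := by
  obtain ⟨t₀, ht₀, γ, hγ, hlowAll⟩ := lower_supported_regular_region_small d L hL1 ha hmsq N
  have hLr : (1 : ℝ) < (L : ℝ) := by exact_mod_cast hL1
  have hinv : ((L : ℝ) ^ 2)⁻¹ < 1 := inv_lt_one_of_one_lt₀ (by nlinarith)
  have hγr : 0 < min 2 (a * (1 - ((L : ℝ) ^ 2)⁻¹) / 4) :=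
    lt_min (by norm_num) (by nlinarith [mul_pos ha (show (0:ℝ) < 1 - ((L : ℝ) ^ 2)⁻¹ by linarith)])
  have hden : (0 : ℝ) < 4 * d + 4 * a := by positivity
  -- the exponent `δ₀ = γ_r/(4d + 4a)` and the uniform kernel constant `c_U` (as in `prop23_regular_region`)
  obtain ⟨δ₀, hδ₀⟩ : ∃ δ₀ : ℝ, δ₀ = min 2 (a * (1 - ((L : ℝ) ^ 2)⁻¹) / 4) / (4 * d + 4 * a) := ⟨_, rfl⟩
  have hδ₀pos : 0 < δ₀ := by rw [hδ₀]; exact div_pos hγr hden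
  obtain ⟨cU, hcU⟩ : ∃ cU : ℝ, cU = a * ((L : ℝ) ^ 2)⁻¹ * Real.exp (δ₀ * ((L : ℝ) - 1)) +
      (a + a ^ 2 * (2 / min 2 (a * (1 - ((L : ℝ) ^ 2)⁻¹) / 4) * Real.exp δ₀)) := ⟨_, rfl⟩
  have hcUpos : 0 < cU := by rw [hcU]; positivity
  -- the threshold: `t₀` of §1 and `d²·t ≤ 1/3` for the Cor.-2.3 input
  obtain ⟨t₁, ht₁⟩ : ∃ t₁ : ℝ, t₁ = min t₀ (1 / (3 * ((d : ℝ) ^ 2 + 1))) := ⟨_, rfl⟩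
  have ht₁pos : 0 < t₁ := by rw [ht₁]; exact lt_min ht₀ (by positivity)
  refine ⟨t₁, cSt (fun t => (nCol N : ℝ) * B4Sect5Proof.latticeConst d t) γ cU δ₀,
    dSt (fun t => (nCol N : ℝ) * B4Sect5Proof.latticeConst d t) γ cU δ₀, ht₁pos, cSt_pos _ _ _ hγ,
    dSt_pos (profile_nonneg d (nCol N)) hγ hcUpos.le hδ₀pos, ?_⟩
  intro C P hPd hPL K R hK j hjK hs hU A δA hδA hreg ht Λ hΛ p q hp hq
  have ht0' : (P.L : ℝ) ^ (j.val + 1) * δA * |C.e| ≤ t₀ := ht.trans (by rw [ht₁]; exact min_le_left _ _)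
  have ht3 : (P.L : ℝ) ^ (j.val + 1) * δA * |C.e| ≤ 1 / (3 * ((d : ℝ) ^ 2 + 1)) :=
    ht.trans (by rw [ht₁]; exact min_le_right _ _)
  have hlow := hlowAll C P hPd hPL R hK j hjK hs hU A hδA hreg ht0'
  subst hPd hPL
  have hPL1 : 1 < P.L := hL1
  -- the Cor.-2.3 smallness `d²·ε|e|·L^{2k}·δ_A ≤ 1/3` from `L^kδ_A|e| ≤ 1/(3(d² + 1))` and `L^kε ≤ 1`
  have hmesh : P.mesh (j.val + 1) = (P.L : ℝ) ^ (j.val + 1) * P.mesh 0 := by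
    unfold HiggsLattice.Params.mesh; ring
  have hm0 : 0 ≤ P.mesh (j.val + 1) := (P.mesh_pos _).le
  have hsmall : (P.d : ℝ) ^ 2 * (P.mesh 0 * |C.e|) * ((P.L : ℝ) ^ (j.val + 1)) ^ 2 * δA ≤ 1 / 3 := by
    have hu0 : 0 ≤ (P.L : ℝ) ^ (j.val + 1) * δA * |C.e| := by positivity
    have h1 : (P.d : ℝ) ^ 2 * (P.mesh 0 * |C.e|) * ((P.L : ℝ) ^ (j.val + 1)) ^ 2 * δA
        = (P.d : ℝ) ^ 2 * (P.mesh (j.val + 1) * ((P.L : ℝ) ^ (j.val + 1) * δA * |C.e|)) := by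
      rw [hmesh]; ring
    rw [h1]
    have h2 : P.mesh (j.val + 1) * ((P.L : ℝ) ^ (j.val + 1) * δA * |C.e|) ≤ 1 * (1 / (3 * ((P.d : ℝ) ^ 2 + 1))) :=
      mul_le_mul hs ht3 hu0 zero_le_one
    have h3 : (P.d : ℝ) ^ 2 * (1 * (1 / (3 * ((P.d : ℝ) ^ 2 + 1)))) ≤ 1 / 3 := by
      rw [one_mul, mul_one_div, div_le_div_iff₀ (by positivity) (by norm_num)]
      nlinarith [sq_nonneg (P.d : ℝ)]
    exact (mul_le_mul_of_nonneg_left h2 (sq_nonneg _)).trans h3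
  -- (5.4) with the uniform constant
  have hδ₀adm : (4 * (P.d : ℝ) + 4 * a) * δ₀ ≤ min 2 (a * (1 - ((P.L : ℝ) ^ 2)⁻¹) / 4) := by
    rw [hδ₀]; exact le_of_eq (mul_div_cancel₀ _ hden.ne')
  have hker : ∀ p q : HiggsLattice.Site P (j.val + 1) × Ix N, p.1 ∈ R.block j → q.1 ∈ R.block j →
      |mat (precOpA C (pieceF R j) A msq a (j.val + 1)) p q| ≤
        cU * (P.mesh (j.val + 1))⁻¹ ^ 2 * Real.exp (-(δ₀ * (HiggsLattice.Site.tdist p.1 q.1 : ℝ))) := by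
    intro p q hp hq
    rw [hcU]
    exact hker_regular_region_uniform R C ha hPL1 hmsq j hjK A hreg hsmall hδ₀pos.le hδ₀adm p q hp hq
  exact ineq234_236_regular_region_of R C ha hPL1 hmsq j hjK.le hs A hγ hlow hcUpos hδ₀pos hker hΛ hp hq

end Prop23

end Literature.MathematicalPhysics.QuantumFieldTheory.Balaban1983to89.B1Prop23RegularRegionSmall

end
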